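import Summits.AtomisticToContinuum.BoseEinsteinCondensation.Theorems.BECThomsonPrincipleGDTransferSeededGradingDefs
import Summits.AtomisticToContinuum.BoseEinsteinCondensation.Theorems.BECThomsonPrincipleGDTransferLnssAlgebraDirections

/-!
# Route `BECThomsonPrinciple`, crux `GDTransfer` (stmt-AtomisticToContinuum-9482), line `seeded-continuity`:
# registered stub `sectorBlockAlgebra` (fixed-`N` seed programme) — the algebra of the `n̂₀`-sector blocks

Supports (does not close) stmt-AtomisticToContinuum-9482.  Proves the registered stub
`sectorBlockAlgebra : SectorBlockAlgebra` of `BECThomsonPrincipleGDTransferSeededGradingDefs.lean`: for every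
set of counts `p` (a decidable predicate on `ℕ`) and every periodic trial state `Ψ` at `(N, L) = (m+1, L)`,
`L > 0`, the block `Ψ_p = sectorBlock m L p Ψ.ψ = Σ_{S : p |S|} Q_S Ψ` of the crux's `Q_S`-decomposition
(`Q_S = Negative.modeProj`) is

* an admissible variation direction (`IsDirection`: `C¹`, `Lℤ³`-periodic in every particle, Bose-symmetric) —
  termwise from `Lnss.contDiff_modeProj`, `Lnss.modeProj_periodic`, and the relabelling covariance
  `Lnss.modeProj_comp_perm` (`(Q_S g)(X ∘ τ) = (Q_{τS} g)(X)` for symmetric `g`) followed by the re-indexing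
  `S ↦ τS` of the sum, which preserves `|S|` and hence the filter `p |S|`;
* of mass the law mass, `‖Ψ_p‖² = P_Ψ(n̂₀ ∈ p) = lawMass m L p Ψ.ψ` — Pythagoras for the orthogonal family `Q_S Ψ`
  (`Lnss.integral_norm_sq_sum_modeProj`) moved to `ℝ≥0∞` by `Lnss.lintegral_nnnorm_sq_eq`;
* complementary to the block of `¬p`, `Ψ_p + Ψ_{¬p} = Ψ` — the two filters partition the subsets and `Σ_S Q_S = 1`
  (`Lnss.sum_modeProj`);
* orthogonal to it, `⟨Ψ_p, Ψ_{¬p}⟩ = 0` — every cross term `⟨Q_S Ψ, Q_T Ψ⟩` has `p |S|`, `¬ p |T|`, so `S ≠ T`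
  (`Lnss.integral_conj_modeProj_mul_modeProj`).

All [folklore] (LSSY2005 App. A: the `P_i` are commuting self-adjoint idempotents on `L²(cell^N)`).
-/

noncomputable section

open MeasureTheory Filter
open scoped ENNReal NNReal ComplexConjugate

namespace Summit.AtomisticToContinuum.BoseEinsteinCondensation.Cruxes.GDTransfer.Seeded

open Literature.MathematicalPhysics.QuantumManyBody.BoseGas
open Summit.AtomisticToContinuum.BoseEinsteinCondensation.Theorems.GaussianDominationCan.Negative (modeProj)
open Summit.AtomisticToContinuum.BoseEinsteinCondensation.Cruxes.GDTransfer.DysonDressedWitness (IsDirection mass)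
open Summit.AtomisticToContinuum.BoseEinsteinCondensation.Cruxes.GDTransfer.DysonDressedWitness.ChordVariation
  (continuous_modeProj)
open Summit.AtomisticToContinuum.BoseEinsteinCondensation.Cruxes.GDTransfer.DysonDressedWitness.Lnss
  (contDiff_modeProj modeProj_periodic modeProj_comp_perm integral_conj_modeProj_mul_modeProj
    integral_norm_sq_sum_modeProj lintegral_nnnorm_sq_eq sum_modeProj)

namespace SectorBlock

variable {m : ℕ} {L : ℝ}

/-! ## Pointwise form and regularity of a block -/

/-- A block evaluated at a configuration: `Ψ_p(X) = Σ_{S : p |S|} (Q_S ψ)(X)`. [folklore] -/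
theorem sectorBlock_apply (p : ℕ → Prop) [DecidablePred p] (ψ : Config (m + 1) → ℂ)
    (X : Config (m + 1)) :
    sectorBlock m L p ψ X =
      ∑ S ∈ (Finset.univ : Finset (Finset (Fin (m + 1)))).filter (fun S => p S.card),
        modeProj (m + 1) L S ψ X := by
  unfold sectorBlock
  rw [Finset.sum_apply]

/-- A block as a lambda over configurations. [folklore] -/
theorem sectorBlock_eq_fun (p : ℕ → Prop) [DecidablePred p] (ψ : Config (m + 1) → ℂ) :
    sectorBlock m L p ψ = fun X =>
      ∑ S ∈ (Finset.univ : Finset (Finset (Fin (m + 1)))).filter (fun S => p S.card),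
        modeProj (m + 1) L S ψ X :=
  funext fun X => sectorBlock_apply p ψ X

/-- **Blocks of `C¹` functions are `C¹`** (`Q_S` preserves `C¹`, finite sum). [folklore] -/
theorem contDiff_sectorBlock (p : ℕ → Prop) [DecidablePred p] {ψ : Config (m + 1) → ℂ}
    (hψ : ContDiff ℝ 1 ψ) : ContDiff ℝ 1 (sectorBlock m L p ψ) := by
  rw [sectorBlock_eq_fun]
  exact ContDiff.sum fun S _ => contDiff_modeProj S hψ

/-- Blocks of continuous functions are continuous. [folklore] -/
theorem continuous_sectorBlock (p : ℕ → Prop) [DecidablePred p] {ψ : Config (m + 1) → ℂ}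
    (hψ : Continuous ψ) : Continuous (sectorBlock m L p ψ) := by
  rw [sectorBlock_eq_fun]
  exact continuous_finsetSum _ fun S _ => continuous_modeProj S hψ

/-- **Blocks of periodic functions are periodic** (`Q_S` preserves periodicity). [folklore] -/
theorem sectorBlock_periodic (p : ℕ → Prop) [DecidablePred p] {ψ : Config (m + 1) → ℂ}
    (hψ : ∀ (X : Config (m + 1)) (j : Fin (m + 1)) (k : Fin 3),
      ψ (X + Pi.single j (EuclideanSpace.single k L)) = ψ X)
    (X : Config (m + 1)) (j : Fin (m + 1)) (k : Fin 3) :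
    sectorBlock m L p ψ (X + Pi.single j (EuclideanSpace.single k L)) = sectorBlock m L p ψ X := by
  rw [sectorBlock_apply, sectorBlock_apply]
  exact Finset.sum_congr rfl fun S _ => modeProj_periodic S hψ X j k

/-- **Blocks of continuous Bose-symmetric functions are Bose-symmetric**: relabelling covariance
`(Q_S ψ)(X ∘ τ) = (Q_{τS} ψ)(X)` and the re-indexing `S ↦ τS`, which preserves `|S|`. [folklore] -/
theorem sectorBlock_comp_perm (p : ℕ → Prop) [DecidablePred p] {ψ : Config (m + 1) → ℂ}
    (hψ : Continuous ψ)
    (hsymm : ∀ (σ : Equiv.Perm (Fin (m + 1))) (X : Config (m + 1)), ψ (X ∘ σ) = ψ X)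
    (τ : Equiv.Perm (Fin (m + 1))) (X : Config (m + 1)) :
    sectorBlock m L p ψ (X ∘ τ) = sectorBlock m L p ψ X := by
  -- adapted from `Lnss.rootInv_comp_perm` of `BECThomsonPrincipleGDTransferLnssAlgebraDirections`
  have hψτ : (fun Y => ψ (Y ∘ τ)) = ψ := funext fun Y => hsymm τ Y
  have hQ : ∀ S : Finset (Fin (m + 1)),
      modeProj (m + 1) L S ψ (X ∘ τ) = modeProj (m + 1) L (S.map τ.toEmbedding) ψ X := by
    intro S
    have h := congrFun (modeProj_comp_perm (L := L) τ S hψ) X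
    rw [hψτ] at h
    exact h
  rw [sectorBlock_apply, sectorBlock_apply]
  simp only [hQ]
  rw [Finset.sum_filter, Finset.sum_filter, ← Equiv.sum_comp (Equiv.finsetCongr τ)
    (fun S : Finset (Fin (m + 1)) => if p S.card then modeProj (m + 1) L S ψ X else 0)]
  refine Finset.sum_congr rfl fun S _ => ?_
  simp only [Equiv.finsetCongr_apply, Finset.card_map]

/-- **Blocks of directions are directions.** [folklore] -/
theorem isDirection_sectorBlock (p : ℕ → Prop) [DecidablePred p] {ψ : Config (m + 1) → ℂ}
    (hψ : IsDirection m L ψ) : IsDirection m L (sectorBlock m L p ψ) :=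
  ⟨contDiff_sectorBlock p hψ.contDiff, sectorBlock_periodic p hψ.periodic,
    fun σ X => sectorBlock_comp_perm p hψ.contDiff.continuous hψ.symm σ X⟩

/-! ## Mass, resolution, orthogonality -/

/-- **The mass of a block is the law mass**: `∫ |Σ_{p|S|} Q_S ψ|² = Σ_{p|S|} ∫ |Q_S ψ|²` (Pythagoras for the
orthogonal family `Q_S ψ`, in `ℝ≥0∞`). [folklore] -/
theorem mass_sectorBlock (hL : 0 < L) (p : ℕ → Prop) [DecidablePred p] {ψ : Config (m + 1) → ℂ}
    (hψ : Continuous ψ) : mass L (sectorBlock m L p ψ) = lawMass m L p ψ := by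
  unfold mass lawMass compMass
  have h : ∀ S : Finset (Fin (m + 1)),
      ∫⁻ X in cellN (m + 1) L, (‖modeProj (m + 1) L S ψ X‖₊ : ℝ≥0∞) ^ 2 =
        ENNReal.ofReal (∫ X in cellN (m + 1) L, ‖modeProj (m + 1) L S ψ X‖ ^ 2) := fun S =>
    lintegral_nnnorm_sq_eq _ (continuous_modeProj S hψ)
  simp only [h]
  rw [lintegral_nnnorm_sq_eq _ (continuous_sectorBlock p hψ),
    ← ENNReal.ofReal_sum_of_nonneg (fun S _ => integral_nonneg fun X => sq_nonneg _)]
  congr 1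
  have hP := integral_norm_sq_sum_modeProj hL
    ((Finset.univ : Finset (Finset (Fin (m + 1)))).filter (fun S => p S.card)) (fun _ => (1 : ℂ)) hψ
  simp only [one_mul, norm_one, one_pow] at hP
  rw [← hP]
  simp only [sectorBlock_apply]

/-- **The blocks of `p` and `¬p` resolve the function**: `Ψ_p + Ψ_{¬p} = ψ` (`Σ_S Q_S = 1`). [folklore] -/
theorem sectorBlock_add_sectorBlock_not (p : ℕ → Prop) [DecidablePred p] (ψ : Config (m + 1) → ℂ)
    (X : Config (m + 1)) :
    sectorBlock m L p ψ X + sectorBlock m L (fun i => ¬ p i) ψ X = ψ X := by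
  rw [sectorBlock_apply, sectorBlock_apply, Finset.sum_filter_add_sum_filter_not]
  have h := congrFun (sum_modeProj (L := L) ψ) X
  rwa [Finset.sum_apply] at h

/-- **The blocks of `p` and `¬p` are orthogonal** in `L²(cell^N)` for continuous `ψ`: every cross term
`⟨Q_S ψ, Q_T ψ⟩` with `p |S|`, `¬ p |T|` has `S ≠ T`. [folklore] -/
theorem integral_conj_sectorBlock_mul_sectorBlock_not (hL : 0 < L) (p : ℕ → Prop) [DecidablePred p]
    {ψ : Config (m + 1) → ℂ} (hψ : Continuous ψ) :
    ∫ X in cellN (m + 1) L, conj (sectorBlock m L p ψ X) * sectorBlock m L (fun i => ¬ p i) ψ X = 0 := by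
  have hQ : ∀ S : Finset (Fin (m + 1)), Continuous (modeProj (m + 1) L S ψ) := fun S =>
    continuous_modeProj S hψ
  have hint : ∀ S T : Finset (Fin (m + 1)), Integrable
      (fun X => conj (modeProj (m + 1) L S ψ X) * modeProj (m + 1) L T ψ X)
      ((volume : Measure (Config (m + 1))).restrict (cellN (m + 1) L)) := fun S T =>
    integrableOn_cellN ((Complex.continuous_conj.comp (hQ S)).mul (hQ T)) L
  calc ∫ X in cellN (m + 1) L, conj (sectorBlock m L p ψ X) * sectorBlock m L (fun i => ¬ p i) ψ X
      = ∫ X in cellN (m + 1) L,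
          ∑ S ∈ (Finset.univ : Finset (Finset (Fin (m + 1)))).filter (fun S => p S.card),
            ∑ T ∈ (Finset.univ : Finset (Finset (Fin (m + 1)))).filter (fun S => ¬ p S.card),
              conj (modeProj (m + 1) L S ψ X) * modeProj (m + 1) L T ψ X := by
        congr 1
        funext X
        rw [sectorBlock_apply, sectorBlock_apply, map_sum, Finset.sum_mul_sum]
    _ = ∑ S ∈ (Finset.univ : Finset (Finset (Fin (m + 1)))).filter (fun S => p S.card),
          ∑ T ∈ (Finset.univ : Finset (Finset (Fin (m + 1)))).filter (fun S => ¬ p S.card),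
            ∫ X in cellN (m + 1) L, conj (modeProj (m + 1) L S ψ X) * modeProj (m + 1) L T ψ X := by
        rw [integral_finsetSum _ fun S _ => integrable_finsetSum _ fun T _ => hint S T]
        exact Finset.sum_congr rfl fun S _ => integral_finsetSum _ fun T _ => hint S T
    _ = 0 := by
        refine Finset.sum_eq_zero fun S hS => Finset.sum_eq_zero fun T hT => ?_
        have hpS : p S.card := (Finset.mem_filter.1 hS).2
        have hpT : ¬ p T.card := (Finset.mem_filter.1 hT).2
        have hST : S ≠ T := fun h => hpT (h ▸ hpS)
        exact integral_conj_modeProj_mul_modeProj hL hST hψ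

end SectorBlock

/-- **Registered stub `sectorBlockAlgebra` of the line `seeded-continuity` (fixed-`N` seed programme).**
ALGEBRA OF SECTOR BLOCKS: for every set of counts `p` and every periodic trial state `Ψ` (`L > 0`), the block
`Ψ_p = Σ_{S : p |S|} Q_S Ψ` is a direction (`C¹`, periodic, Bose-symmetric), its mass is the law mass
`P_Ψ(n̂₀ ∈ p)`, the blocks of `p` and `¬p` resolve `Ψ`, and they are orthogonal in `L²(cell^N)`. [folklore] -/
theorem sectorBlockAlgebra : SectorBlockAlgebra := by
  intro m L hL p _ Ψ
  have hψ : Continuous Ψ.ψ := Ψ.contDiff.continuous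
  exact ⟨SectorBlock.isDirection_sectorBlock p ⟨Ψ.contDiff, Ψ.periodic, Ψ.symm⟩,
    SectorBlock.mass_sectorBlock hL p hψ,
    fun X => SectorBlock.sectorBlock_add_sectorBlock_not p Ψ.ψ X,
    SectorBlock.integral_conj_sectorBlock_mul_sectorBlock_not hL p hψ⟩

end Summit.AtomisticToContinuum.BoseEinsteinCondensation.Cruxes.GDTransfer.Seeded

end
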